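import Mathlib
import HarnessLib
import Literature.Analysis.FluidPDE.SpaceTimeRescaling
import Literature.Analysis.FluidPDE.SuitableWeak
import Literature.Analysis.FluidPDE.LocalTypeI
import Summits.NavierStokesRegularity.NavierStokesRegularity.Theorems.QuarterLogPincerTypeIQuantSubcubicExpZoomSlice

/-!
# Crux `QuarterLogPincer.TypeIQuantSubcubicExp` (stmt-NavierStokesRegularity-24077), line `thin_cascade`:
  transport of the local ENERGY clause to the zoom — the `A` part of the uniform local Type-I bound

Helper file (`--supports stmt-NavierStokesRegularity-24077 --as helper`, lead prover ns-tc-p1) toward the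
registered stub `stub_thinObjectExtraction` (skeleton v5), part (3) step 2 of the plan attached to the item
(`S2-PLAN-v5-remaining.md`): the only input still missing for `isBackwardSingularPoint_zoomLimit`
(`…ZoomSingular`) is a uniform bound of Albritton–Barker's `typeIBound = sup (A + C + D + E)` for the zooms,
to be transported from the 4th stub `UniformScaledEnergy` (clauses `A`, `E`, `D` of the ORIGINAL frame at
every final vertex).  This file does the `A` part:

* `lintegral_sq_ball_zoom` — `∫_{B(c,r)} ‖w(s,y)‖² dy = ρ⁻¹ ∫_{B(x₀+ρc, ρr)} ‖u(T+ρ²s, x)‖² dx` for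
  `w = ρ • stPull (ρ²) ρ T x₀ u` (substitution `x = x₀ + ρy`: `dx = ρ³dy`, `‖w‖² = ρ²‖u‖²`);
* `cknA_zoom_le` — if the frame satisfies the `A`-clause of `UniformScaledEnergy` at the vertex
  `(T + ρ² z.1, x₀ + ρ z.2)` and radius `ρ r`, i.e. `∫_{B(x₀+ρz.2, ρr)} ‖u(t)‖² ≤ C ρ r` for
  `t ∈ [T + ρ²z.1 − (ρr)², T + ρ²z.1]`, then `A(Q(z,r); w) ≤ C` (`cknA`, hence `cknAEss`, `≤ ofReal C`).

The `E`, `D` parts (space–time substitution, chain rule, ball means) and the `C` part (`cknC_le_of_rate`)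
are NOT here.  HONEST FRAMING: bookkeeping toward one registered stub of an open crux; nothing about
Navier–Stokes regularity is proved; no summit statement is proved by this file.
-/

noncomputable section

-- the summit-side namespace `Summit.NavierStokesRegularity.NavierStokesRegularity.…` (single-conjunct summit,
-- D-0017) repeats a component by design; the dupNamespace linter would flag every declaration.
set_option linter.dupNamespace false

namespace Summit.NavierStokesRegularity.NavierStokesRegularity.Theorems.ThinCascade

open MeasureTheory Set Function Metric
open scoped ENNReal NNReal
open Literature.Analysis Literature.Analysis.FluidPDE

/-- **Scale covariance of the local energy of a slice**: for `w = ρ • stPull (ρ²) ρ T x₀ u`, `ρ > 0`,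
`∫_{B(c,r)} ‖w(s,y)‖ₑ² dy = ρ⁻¹ ∫_{B(x₀+ρc, ρr)} ‖u(T+ρ²s, x)‖ₑ² dx`. [folklore] -/
theorem lintegral_sq_ball_zoom {ρ : ℝ} (hρ : 0 < ρ) (T : ℝ) (x₀ : EuclideanSpace ℝ (Fin 3))
    (u : ℝ → EuclideanSpace ℝ (Fin 3) → EuclideanSpace ℝ (Fin 3)) (s : ℝ)
    (c : EuclideanSpace ℝ (Fin 3)) (r : ℝ) :
    ∫⁻ y in ball c r, ‖(ρ • stPull (ρ ^ 2) ρ T x₀ u) s y‖ₑ ^ 2 =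
      (ENNReal.ofReal ρ)⁻¹ *
        ∫⁻ x in ball (x₀ + ρ • c) (ρ * r), ‖u (T + ρ ^ 2 * s) x‖ₑ ^ 2 := by
  set B : Set (EuclideanSpace ℝ (Fin 3)) := ball c r with hB
  set B' : Set (EuclideanSpace ℝ (Fin 3)) := ball (x₀ + ρ • c) (ρ * r) with hB'
  set G : EuclideanSpace ℝ (Fin 3) → ℝ≥0∞ :=
    B'.indicator fun x => ‖u (T + ρ ^ 2 * s) x‖ₑ ^ 2 with hG
  have hmem : ∀ y, y ∈ B ↔ ρ • y + x₀ ∈ B' := by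
    intro y
    rw [hB, hB', mem_ball, mem_ball, dist_eq_norm, dist_eq_norm,
      show ρ • y + x₀ - (x₀ + ρ • c) = ρ • (y - c) by rw [smul_sub]; abel,
      norm_smul, Real.norm_of_nonneg hρ.le]
    exact ⟨fun h => by nlinarith, fun h => by nlinarith⟩
  have key : ∀ y, B.indicator (fun y => ‖(ρ • stPull (ρ ^ 2) ρ T x₀ u) s y‖ₑ ^ 2) y =
      ENNReal.ofReal (ρ ^ 2) * G (ρ • y + x₀) := by
    intro y
    by_cases hy : y ∈ B
    · rw [indicator_of_mem hy, hG, indicator_of_mem ((hmem y).1 hy), smul_stPull_apply, enorm_smul,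
        mul_pow, Real.enorm_eq_ofReal hρ.le, ← ENNReal.ofReal_pow hρ.le, add_comm x₀]
    · rw [indicator_of_notMem hy, hG, indicator_of_notMem (fun h => hy ((hmem y).2 h)), mul_zero]
  have hBm : MeasurableSet B := measurableSet_ball
  have hB'm : MeasurableSet B' := measurableSet_ball
  rw [← lintegral_indicator hBm, ← lintegral_indicator hB'm]
  simp_rw [key]
  rw [lintegral_const_mul' _ _ ENNReal.ofReal_ne_top, lintegral_comp_smul_add_fin_three G hρ.ne' x₀,
    ← mul_assoc, ← ENNReal.ofReal_mul (by positivity)]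
  congr 1
  rw [abs_of_pos (by positivity), ← ENNReal.ofReal_inv_of_pos hρ]
  congr 1
  field_simp

/-- **The `A` part of the uniform local Type-I bound of the zoom.**  If the original frame obeys the
`A`-clause of `UniformScaledEnergy` at the vertex `(T + ρ²z.1, x₀ + ρz.2)` and radius `ρr`
(`∫_{B(x₀+ρz.2, ρr)} ‖u(t)‖² ≤ C ρ r` for `t ∈ [T + ρ²z.1 − (ρr)², T + ρ²z.1]`), then Albritton–Barker's
scaled energy of the zoom `w = ρ • stPull (ρ²) ρ T x₀ u` on `Q(z, r)` is at most `C`: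
`cknA r z w ≤ ofReal C` (so also `cknAEss r z w ≤ ofReal C`, `cknAEss_le_cknA`). [folklore] -/
theorem cknA_zoom_le {ρ C T r : ℝ} (hρ : 0 < ρ) (hr : 0 < r) {x₀ : EuclideanSpace ℝ (Fin 3)}
    {u : ℝ → EuclideanSpace ℝ (Fin 3) → EuclideanSpace ℝ (Fin 3)}
    {z : ℝ × EuclideanSpace ℝ (Fin 3)}
    (hA : ∀ t ∈ Icc (T + ρ ^ 2 * z.1 - (ρ * r) ^ 2) (T + ρ ^ 2 * z.1),
      ∫⁻ x in ball (x₀ + ρ • z.2) (ρ * r), ENNReal.ofReal (‖u t x‖ ^ 2) ≤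
        ENNReal.ofReal (C * (ρ * r))) :
    cknA r z (ρ • stPull (ρ ^ 2) ρ T x₀ u) ≤ ENNReal.ofReal C := by
  rw [cknA]
  refine iSup₂_le fun s hs => ?_
  rw [lintegral_sq_ball_zoom hρ T x₀ u s z.2 r]
  have hs' : T + ρ ^ 2 * s ∈ Icc (T + ρ ^ 2 * z.1 - (ρ * r) ^ 2) (T + ρ ^ 2 * z.1) := by
    have hρ2 : 0 < ρ ^ 2 := by positivity
    constructor
    · have := mul_le_mul_of_nonneg_left hs.1.le hρ2.le
      nlinarith
    · nlinarith [hs.2]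
  have h1 : ∫⁻ x in ball (x₀ + ρ • z.2) (ρ * r), ‖u (T + ρ ^ 2 * s) x‖ₑ ^ 2 ≤
      ENNReal.ofReal (C * (ρ * r)) := by
    refine le_trans (le_of_eq (lintegral_congr fun x => ?_)) (hA _ hs')
    rw [← ofReal_norm, ENNReal.ofReal_pow (norm_nonneg _)]
  calc (ENNReal.ofReal r)⁻¹ * ((ENNReal.ofReal ρ)⁻¹ *
        ∫⁻ x in ball (x₀ + ρ • z.2) (ρ * r), ‖u (T + ρ ^ 2 * s) x‖ₑ ^ 2)
      ≤ (ENNReal.ofReal r)⁻¹ * ((ENNReal.ofReal ρ)⁻¹ * ENNReal.ofReal (C * (ρ * r))) := by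
        gcongr
    _ = ENNReal.ofReal C := by
        have hC : ENNReal.ofReal (C * (ρ * r)) = ENNReal.ofReal C * ENNReal.ofReal ρ * ENNReal.ofReal r := by
          rcases le_or_gt 0 C with hC0 | hC0
          · rw [ENNReal.ofReal_mul hC0, ENNReal.ofReal_mul hρ.le, mul_assoc]
          · rw [ENNReal.ofReal_of_nonpos (by nlinarith [mul_pos hρ hr]),
              ENNReal.ofReal_of_nonpos hC0.le, zero_mul, zero_mul]
        rw [hC]
        have hr' : ENNReal.ofReal r ≠ 0 := (ENNReal.ofReal_pos.2 hr).ne'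
        have hρ' : ENNReal.ofReal ρ ≠ 0 := (ENNReal.ofReal_pos.2 hρ).ne'
        calc (ENNReal.ofReal r)⁻¹ * ((ENNReal.ofReal ρ)⁻¹ *
              (ENNReal.ofReal C * ENNReal.ofReal ρ * ENNReal.ofReal r))
            = ENNReal.ofReal C * ((ENNReal.ofReal ρ)⁻¹ * ENNReal.ofReal ρ) *
                ((ENNReal.ofReal r)⁻¹ * ENNReal.ofReal r) := by ring
          _ = ENNReal.ofReal C := by
              rw [ENNReal.inv_mul_cancel hρ' ENNReal.ofReal_ne_top,
                ENNReal.inv_mul_cancel hr' ENNReal.ofReal_ne_top, mul_one, mul_one]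

end Summit.NavierStokesRegularity.NavierStokesRegularity.Theorems.ThinCascade

end
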